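import Mathlib
import HarnessLib
import Summits.QuantumFields.YangMills.Theorems.ComplexCouplingChannelContinuumLegGivenGapProductToUniformDefs
import Summits.QuantumFields.YangMills.Theorems.ComplexCouplingChannelContinuumLegGivenGapPtuAssemblyKit

/-!
# `ContinuumLegGivenGap` (stmt-QuantumFields-15828), line `alternating-curvature-arrays`: `stub_ptuAssembly`, the NEAR and OUTER lattice sums

Support file for `stub_ptuAssembly`.  The two pieces of the lattice decomposition that do NOT use (PB):
* `ptuNO_weighted_sum_le` — a lattice sum `∑ₓ w(a x) F(a x) c_k(x)` with a weight `|w| ≤ 1` is at most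
  `(12 N)^p ∑_{x : w(a x) ≠ 0} ‖F(a x)‖` (`abs_centredMoment_le`);
* `ptuNO_near_le` (registered anchor) — the NEAR sum (weight `near/W ∈ [0,1]`, non-zero only at configurations with a pair
  closer than `ptuR p` lattice units, the near criterion of piece 1): by the landed `nearDiag_sum_norm_le` and
  `ptuR p ≤ 13824 (p+1)`, `‖NEAR‖ ≤ Ω₂^{p+1} (p+1)^{4(p+1)} |F|_{6p}`, `Ω₂ = 2 + 12N · 1024 K₀ · 13824⁴`;
* `ptuNO_out_le` — the OUTER sum (weight `out/W ∈ [0,1]`, non-zero only at configurations with a coordinate beyond `L/8`,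
  the outer criterion of piece 1): by the seam bound of piece 3, `‖OUT‖ ≤ ((12N+1) c₃ 2^{16N₁})^{p+1} |F|_{p(4N₁+6)}`.
No definitions. [folklore]
-/

set_option autoImplicit false

noncomputable section

open scoped Classical

namespace Summit.QuantumFields.YangMills.Theorems.ContinuumLegGivenGap

open scoped SchwartzMap BigOperators
open MeasureTheory Filter Topology
open Literature.MathematicalPhysics.QuantumFieldTheory Literature.MathematicalPhysics.QuantumLattice
  Literature.MathematicalPhysics.AQFT
open Literature.Probability.LatticeModels (box Site)
open Summit.QuantumFields.YangMills.Cruxes.ContinuumLimitOnTrajectory.TwoOrbitSynchronisation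
  (PlaqIdx plaq canonDistribution)
open Summit.QuantumFields.YangMills.Theorems.ContinuumLimitExists.Negative (centredMoment abs_centredMoment_le)
open Summit.QuantumFields.YangMills.Theorems.ContinuumLegGivenGap.AlternatingArrays (cellSide)

section NearOut

variable {G : Type} [Group G] [TopologicalSpace G] [IsTopologicalGroup G] [CompactSpace G]
  [MeasurableSpace G] [BorelSpace G]

/-- **Weighted lattice sums with weights in `[-1, 1]`**: `‖∑ₓ w(a x) F(a x) c_k(x)‖ ≤ (12N)^p ∑_{x : w(a x) ≠ 0} ‖F(a x)‖`.
[folklore] -/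
theorem ptuNO_weighted_sum_le (r : LatticeRep G) (sch : SpeciesScheme (YMSpecies G)) (k p : ℕ)
    (q : Fin p → PlaqIdx) (F : 𝓢((Fin p → EuclideanSpace ℝ (Fin 4)), ℂ)) (w : (Fin p → EuclideanSpace ℝ (Fin 4)) → ℝ) (hw : ∀ y, |w y| ≤ 1) :
    ‖∑ x : Fin p → ↥(box 4 (sch.L k)), ((w (fun i => sch.a k • siteToE (↑(x i) : Site 4)) : ℝ) : ℂ) * F (fun i => sch.a k • siteToE (↑(x i) : Site 4)) * ((centredMoment r (sch.L k) (sch.β k) p (fun i => some (q i)) (fun i => (x i : Site 4)) : ℝ) : ℂ)‖ ≤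
      (12 * (r.N : ℝ)) ^ p * ∑ x ∈ (Finset.univ : Finset (Fin p → ↥(box 4 (sch.L k)))).filter
        (fun x => w (fun i => sch.a k • siteToE (↑(x i) : Site 4)) ≠ 0), ‖F (fun i => sch.a k • siteToE (↑(x i) : Site 4))‖ := by
  refine (norm_sum_le _ _).trans ?_
  -- terms with zero weight vanish
  rw [← Finset.sum_filter_of_ne (p := fun x : Fin p → ↥(box 4 (sch.L k)) => w (fun i => sch.a k • siteToE (↑(x i) : Site 4)) ≠ 0)
    (fun x _ hx => fun h0 => hx (by rw [h0, Complex.ofReal_zero, zero_mul, zero_mul, norm_zero]))]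
  rw [Finset.mul_sum]
  refine Finset.sum_le_sum fun x _ => ?_
  rw [norm_mul, norm_mul, Complex.norm_real, Complex.norm_real, Real.norm_eq_abs, Real.norm_eq_abs]
  calc |w (fun i => sch.a k • siteToE (↑(x i) : Site 4))| * ‖F (fun i => sch.a k • siteToE (↑(x i) : Site 4))‖ *
        |centredMoment r (sch.L k) (sch.β k) p (fun i => some (q i)) (fun i => (x i : Site 4))|
      ≤ 1 * ‖F (fun i => sch.a k • siteToE (↑(x i) : Site 4))‖ * (12 * (r.N : ℝ)) ^ p :=
        mul_le_mul (mul_le_mul_of_nonneg_right (hw _) (norm_nonneg _)) (abs_centredMoment_le r _ _ p _ _)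
          (abs_nonneg _) (by positivity)
    _ = (12 * (r.N : ℝ)) ^ p * ‖F (fun i => sch.a k • siteToE (↑(x i) : Site 4))‖ := by ring

/-- Lattice coordinates of the scaled configuration: `(a • siteToE x) μ = a · x_μ`. [folklore] -/
theorem ptuNO_smul_siteToE_apply (a : ℝ) (x : Site 4) (μ : Fin 4) : (a • siteToE x) μ = a * (x μ : ℝ) := by
  rw [PiLp.smul_apply, smul_eq_mul, siteToE_apply]

set_option maxHeartbeats 1000000 in
/-- **The NEAR sum** (registered anchor): at a step with `0 < a ≤ 1`, if the near weight takes values in `[0,1]`, the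
normaliser is `≥ 1`, and `near ≠ 0` forces a pair of points closer than `ptuR p · a` in every coordinate, then
`‖NEAR‖ ≤ Ω₂^{p+1} (p+1)^{4(p+1)} |F|_{p·6}`, `Ω₂ = 2 + 12N · 1024 K₀ · 13824⁴`, `K₀ = 81 ∑ₘ (m+1)⁻²`. [folklore] -/
theorem ptuNO_near_le : ∀ (G : Type) [Group G] [TopologicalSpace G] [IsTopologicalGroup G] [CompactSpace G]
    [MeasurableSpace G] [BorelSpace G] (r : LatticeRep G) (sch : SpeciesScheme (YMSpecies G)) (k p : ℕ)
    (q : Fin p → PlaqIdx) (F : 𝓢((Fin p → EuclideanSpace ℝ (Fin 4)), ℂ)), IsOffDiagonal F → sch.a k ≤ 1 →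
    (∀ y : Fin p → EuclideanSpace ℝ (Fin 4), 0 ≤ ptuNear (sch.a k) p y ∧ ptuNear (sch.a k) p y ≤ 1) →
    (∀ y : Fin p → EuclideanSpace ℝ (Fin 4), 1 ≤ ptuW (sch.a k) (sch.L k) p y) →
    (∀ y : Fin p → EuclideanSpace ℝ (Fin 4), ptuNear (sch.a k) p y ≠ 0 →
      ∃ i j : Fin p, i ≠ j ∧ ∀ μ : Fin 4, |y i μ - y j μ| < (ptuR p : ℝ) * sch.a k) →
    ‖∑ x : Fin p → ↥(box 4 (sch.L k)),
        ((ptuNear (sch.a k) p (fun i => sch.a k • siteToE (↑(x i) : Site 4)) /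
            ptuW (sch.a k) (sch.L k) p (fun i => sch.a k • siteToE (↑(x i) : Site 4)) : ℝ) : ℂ) *
          F (fun i => sch.a k • siteToE (↑(x i) : Site 4)) *
          ((centredMoment r (sch.L k) (sch.β k) p (fun i => some (q i)) (fun i => (x i : Site 4)) : ℝ) : ℂ)‖ ≤
      (2 + 12 * (r.N : ℝ) * (1024 * (81 * ∑' m : ℕ, (((m : ℝ) + 1) ^ 2)⁻¹) * 13824 ^ 4)) ^ (p + 1) *
        ((p : ℝ) + 1) ^ (4 * (p + 1)) * schwartzNorm (p * 6) F := by
  intro G _ _ _ _ _ _ r sch k p q F hF ha1 h01 hW1 hcrit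
  have ha : 0 < sch.a k := sch.a_pos k
  have hR0 : 0 ≤ (ptuR p : ℝ) := Nat.cast_nonneg _
  have hRle : (ptuR p : ℝ) ≤ 13824 * ((p : ℝ) + 1) := ptuKit_ptuR_le p
  -- weights in `[0, 1]`
  have hwle : ∀ y : (Fin p → EuclideanSpace ℝ (Fin 4)), |ptuNear (sch.a k) p y / ptuW (sch.a k) (sch.L k) p y| ≤ 1 := fun y => by
    have h1 := hW1 y
    rw [abs_div, abs_of_nonneg (h01 y).1, abs_of_pos (by linarith)]
    exact (div_le_one (by linarith)).2 ((h01 y).2.trans h1)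
  have hstep := ptuNO_weighted_sum_le r sch k p q F
    (fun y => ptuNear (sch.a k) p y / ptuW (sch.a k) (sch.L k) p y) hwle
  -- the configurations with non-zero weight are near-diagonal
  set S := (Finset.univ : Finset (Fin p → ↥(box 4 (sch.L k)))).filter
    (fun x => ptuNear (sch.a k) p (fun i => sch.a k • siteToE (↑(x i) : Site 4)) / ptuW (sch.a k) (sch.L k) p (fun i => sch.a k • siteToE (↑(x i) : Site 4)) ≠ 0) with hS
  have hinj : Set.InjOn (fun (c : Fin p → ↥(box 4 (sch.L k))) (i : Fin p) => ((c i : Site 4) : Fin 4 → ℤ)) S :=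
    fun c _ c' _ h => funext fun i => Subtype.ext (congrFun h i)
  have hnear : ∀ c ∈ S, ∃ i j : Fin p, i ≠ j ∧ ‖((c i : Site 4) : Fin 4 → ℤ) - (c j : Site 4)‖ ≤ (ptuR p : ℝ) := by
    intro c hc
    have hwc := (Finset.mem_filter.1 hc).2
    have hn : ptuNear (sch.a k) p (fun i => sch.a k • siteToE (↑(c i) : Site 4)) ≠ 0 := fun h0 =>
      hwc (by rw [h0, zero_div])
    obtain ⟨i, j, hij, hμ⟩ := hcrit _ hn
    refine ⟨i, j, hij, (pi_norm_le_iff_of_nonneg hR0).2 fun μ => ?_⟩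
    have h := hμ μ
    rw [ptuNO_smul_siteToE_apply, ptuNO_smul_siteToE_apply, ← mul_sub, abs_mul, abs_of_pos ha] at h
    rw [Pi.sub_apply, Int.norm_eq_abs, Int.cast_sub]
    nlinarith
  have hND := nearDiag_sum_norm_le p F hF (sch.a k) (ptuR p : ℝ) ha ha1 hR0 _ S _ hinj hnear
  -- opaque constants
  have hK0 : (0 : ℝ) ≤ 81 * ∑' m : ℕ, (((m : ℝ) + 1) ^ 2)⁻¹ :=
    mul_nonneg (by norm_num) (tsum_nonneg fun m => by positivity)
  generalize hK₀ : (81 * ∑' m : ℕ, (((m : ℝ) + 1) ^ 2)⁻¹ : ℝ) = K₀ at hND hK0 ⊢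
  generalize hR : ((ptuR p : ℕ) : ℝ) = R at hND hR0 hRle ⊢
  have hN0 : (0 : ℝ) ≤ 12 * (r.N : ℝ) := by positivity
  have hY0 : (0 : ℝ) ≤ 1024 * K₀ * 13824 ^ 4 := by positivity
  have hΩ2 : (2 : ℝ) ≤ 2 + 12 * (r.N : ℝ) * (1024 * K₀ * 13824 ^ 4) := by nlinarith
  generalize hΩ₂ : (2 + 12 * (r.N : ℝ) * (1024 * K₀ * 13824 ^ 4) : ℝ) = Ω₂ at hΩ2 ⊢
  have hΩ0 : 0 ≤ Ω₂ := by linarith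
  -- Schwartz seminorms and the shape
  have hsem : SchwartzMap.seminorm ℂ 0 (4 * p) F + SchwartzMap.seminorm ℂ (6 * p) (4 * p) F ≤
      2 * schwartzNorm (p * 6) F := by
    have h1 : SchwartzMap.seminorm ℂ 0 (4 * p) F ≤ schwartzNorm (p * 6) F :=
      seminorm_le_schwartzNorm (by omega) (by omega) F
    have h2 : SchwartzMap.seminorm ℂ (6 * p) (4 * p) F ≤ schwartzNorm (p * 6) F :=
      seminorm_le_schwartzNorm (by omega) (by omega) F
    linarith
  have hsN : 0 ≤ schwartzNorm (p * 6) F := schwartzNorm_nonneg _ _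
  have hp1 : (1 : ℝ) ≤ (p : ℝ) + 1 := by linarith [(Nat.cast_nonneg p : (0 : ℝ) ≤ p)]
  have hR4 : R ^ 4 ≤ 13824 ^ 4 * ((p : ℝ) + 1) ^ 4 := by
    rw [← mul_pow]; exact pow_le_pow_left₀ hR0 hRle 4
  have hbase : 12 * (r.N : ℝ) * (1024 * K₀ * R ^ 4) ≤ Ω₂ * ((p : ℝ) + 1) ^ 4 := by
    have h1 : 1024 * K₀ * R ^ 4 ≤ 1024 * K₀ * (13824 ^ 4 * ((p : ℝ) + 1) ^ 4) :=
      mul_le_mul_of_nonneg_left hR4 (by positivity)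
    have h2 : 12 * (r.N : ℝ) * (1024 * K₀ * 13824 ^ 4) ≤ Ω₂ := by rw [← hΩ₂]; linarith
    calc 12 * (r.N : ℝ) * (1024 * K₀ * R ^ 4) ≤ 12 * (r.N : ℝ) * (1024 * K₀ * (13824 ^ 4 * ((p : ℝ) + 1) ^ 4)) :=
          mul_le_mul_of_nonneg_left h1 hN0
      _ = (12 * (r.N : ℝ) * (1024 * K₀ * 13824 ^ 4)) * ((p : ℝ) + 1) ^ 4 := by ring
      _ ≤ Ω₂ * ((p : ℝ) + 1) ^ 4 := mul_le_mul_of_nonneg_right h2 (by positivity)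
  have hY : (0 : ℝ) ≤ 1024 * K₀ * R ^ 4 := by positivity
  have hT : ∑ x ∈ S, ‖F (fun i => sch.a k • siteToE (↑(x i) : Site 4))‖ ≤ (1024 * K₀ * R ^ 4) ^ p * (2 * schwartzNorm (p * 6) F) :=
    hND.trans (mul_le_mul_of_nonneg_left hsem (pow_nonneg hY p))
  have h1 : (12 * (r.N : ℝ)) ^ p * ((1024 * K₀ * R ^ 4) ^ p * (2 * schwartzNorm (p * 6) F)) =
      (12 * (r.N : ℝ) * (1024 * K₀ * R ^ 4)) ^ p * 2 * schwartzNorm (p * 6) F := by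
    rw [mul_pow (12 * (r.N : ℝ)) (1024 * K₀ * R ^ 4) p]; ring
  have h2 : (12 * (r.N : ℝ) * (1024 * K₀ * R ^ 4)) ^ p * 2 ≤ (Ω₂ * ((p : ℝ) + 1) ^ 4) ^ p * Ω₂ :=
    mul_le_mul (pow_le_pow_left₀ (mul_nonneg hN0 hY) hbase p) hΩ2 (by norm_num)
      (pow_nonneg (mul_nonneg hΩ0 (by positivity)) p)
  have h3 : (Ω₂ * ((p : ℝ) + 1) ^ 4) ^ p * Ω₂ = Ω₂ ^ (p + 1) * ((p : ℝ) + 1) ^ (4 * p) := by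
    rw [mul_pow Ω₂ (((p : ℝ) + 1) ^ 4) p, ← pow_mul ((p : ℝ) + 1) 4 p, pow_succ Ω₂ p]; ring
  have h4 : ((p : ℝ) + 1) ^ (4 * p) ≤ ((p : ℝ) + 1) ^ (4 * (p + 1)) := pow_le_pow_right₀ hp1 (by omega)
  calc _ ≤ (12 * (r.N : ℝ)) ^ p * ∑ x ∈ S, ‖F (fun i => sch.a k • siteToE (↑(x i) : Site 4))‖ := hstep
    _ ≤ (12 * (r.N : ℝ)) ^ p * ((1024 * K₀ * R ^ 4) ^ p * (2 * schwartzNorm (p * 6) F)) :=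
        mul_le_mul_of_nonneg_left hT (pow_nonneg hN0 p)
    _ = (12 * (r.N : ℝ) * (1024 * K₀ * R ^ 4)) ^ p * 2 * schwartzNorm (p * 6) F := h1
    _ ≤ (Ω₂ * ((p : ℝ) + 1) ^ 4) ^ p * Ω₂ * schwartzNorm (p * 6) F := mul_le_mul_of_nonneg_right h2 hsN
    _ = Ω₂ ^ (p + 1) * ((p : ℝ) + 1) ^ (4 * p) * schwartzNorm (p * 6) F := by rw [h3]
    _ ≤ Ω₂ ^ (p + 1) * ((p : ℝ) + 1) ^ (4 * (p + 1)) * schwartzNorm (p * 6) F :=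
        mul_le_mul_of_nonneg_right (mul_le_mul_of_nonneg_left h4 (pow_nonneg hΩ0 _)) hsN

set_option maxHeartbeats 1000000 in
/-- **The OUTER sum**: at a step with `0 < a ≤ 1` and `a⁻¹ ≤ (aL)^{N₁}`, if the outer weight takes values in `[0,1]`, the
normaliser is `≥ 1`, and `out ≠ 0` forces a coordinate `|yᵢμ| > aL/8`, then by the seam bound of piece 3 (`hSeam`,
constant `c₃`) `‖OUT‖ ≤ ((12N+1) c₃ 2^{16N₁})^{p+1} |F|_{p(4N₁+6)}`. [folklore] -/
theorem ptuNO_out_le (r : LatticeRep G) (sch : SpeciesScheme (YMSpecies G)) (k p : ℕ) (q : Fin p → PlaqIdx)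
    (F : 𝓢((Fin p → EuclideanSpace ℝ (Fin 4)), ℂ)) {N₁ : ℕ} {c₃ : ℝ} (hc₃ : 0 < c₃) (ha1 : sch.a k ≤ 1)
    (hpvg : (sch.a k)⁻¹ ≤ (sch.a k * sch.L k) ^ N₁)
    (h01 : ∀ y : (Fin p → EuclideanSpace ℝ (Fin 4)), 0 ≤ ptuOut (sch.a k) (sch.L k) p y ∧ ptuOut (sch.a k) (sch.L k) p y ≤ 1)
    (hW1 : ∀ y : (Fin p → EuclideanSpace ℝ (Fin 4)), 1 ≤ ptuW (sch.a k) (sch.L k) p y)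
    (hcrit : ∀ y : (Fin p → EuclideanSpace ℝ (Fin 4)), ptuOut (sch.a k) (sch.L k) p y ≠ 0 → ∃ (i : Fin p) (μ : Fin 4), sch.a k * (sch.L k : ℝ) / 8 < |y i μ|)
    (hSeam : ∀ (N p : ℕ) (a : ℝ) (L : ℕ) (F : 𝓢((Fin p → EuclideanSpace ℝ (Fin 4)), ℂ)),
      0 < a → a ≤ 1 → a⁻¹ ≤ (a * L) ^ N →
      ∑ x ∈ (Finset.univ : Finset (Fin p → ↥(box 4 L))).filter
          (fun x => ∃ (i : Fin p) (μ : Fin 4), (L : ℝ) < 8 * |(((x i : Site 4) μ : ℤ) : ℝ)|),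
        ‖F (fun i => a • siteToE (↑(x i) : Site 4))‖ ≤
        (c₃ * 2 ^ (16 * N)) ^ (p + 1) * schwartzNorm (p * (4 * N + 6)) F) :
    ‖∑ x : Fin p → ↥(box 4 (sch.L k)),
        ((ptuOut (sch.a k) (sch.L k) p (fun i => sch.a k • siteToE (↑(x i) : Site 4)) / ptuW (sch.a k) (sch.L k) p (fun i => sch.a k • siteToE (↑(x i) : Site 4)) : ℝ) : ℂ) *
          F (fun i => sch.a k • siteToE (↑(x i) : Site 4)) * ((centredMoment r (sch.L k) (sch.β k) p (fun i => some (q i)) (fun i => (x i : Site 4)) : ℝ) : ℂ)‖ ≤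
      ((12 * (r.N : ℝ) + 1) * (c₃ * 2 ^ (16 * N₁))) ^ (p + 1) * schwartzNorm (p * (4 * N₁ + 6)) F := by
  have ha : 0 < sch.a k := sch.a_pos k
  set w : (Fin p → EuclideanSpace ℝ (Fin 4)) → ℝ := fun y => ptuOut (sch.a k) (sch.L k) p y / ptuW (sch.a k) (sch.L k) p y with hw
  have hwle : ∀ y, |w y| ≤ 1 := fun y => by
    have h1 := hW1 y
    rw [hw]; dsimp only
    rw [abs_div, abs_of_nonneg (h01 y).1, abs_of_pos (by linarith)]
    exact (div_le_one (by linarith)).2 ((h01 y).2.trans h1)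
  have hstep := ptuNO_weighted_sum_le r sch k p q F w hwle
  have hseam := hSeam N₁ p (sch.a k) (sch.L k) F ha ha1 hpvg
  -- the configurations with non-zero weight have a coordinate beyond `L/8`
  have hsub : (Finset.univ : Finset (Fin p → ↥(box 4 (sch.L k)))).filter (fun x => w (fun i => sch.a k • siteToE (↑(x i) : Site 4)) ≠ 0) ⊆
      (Finset.univ : Finset (Fin p → ↥(box 4 (sch.L k)))).filter
        (fun x => ∃ (i : Fin p) (μ : Fin 4), (sch.L k : ℝ) < 8 * |(((x i : Site 4) μ : ℤ) : ℝ)|) := by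
    intro x hx
    rw [Finset.mem_filter] at hx ⊢
    refine ⟨Finset.mem_univ _, ?_⟩
    have hn : ptuOut (sch.a k) (sch.L k) p (fun i => sch.a k • siteToE (↑(x i) : Site 4)) ≠ 0 := fun h0 =>
      hx.2 (by rw [hw]; dsimp only; rw [h0, zero_div])
    obtain ⟨i, μ, hμ⟩ := hcrit _ hn
    refine ⟨i, μ, ?_⟩
    rw [ptuNO_smul_siteToE_apply, abs_mul, abs_of_pos ha] at hμ
    nlinarith
  have hsN : 0 ≤ schwartzNorm (p * (4 * N₁ + 6)) F := schwartzNorm_nonneg _ _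
  have hN0 : (0 : ℝ) ≤ 12 * (r.N : ℝ) := by positivity
  calc _ ≤ (12 * (r.N : ℝ)) ^ p * ∑ x ∈ (Finset.univ : Finset (Fin p → ↥(box 4 (sch.L k)))).filter
        (fun x => w (fun i => sch.a k • siteToE (↑(x i) : Site 4)) ≠ 0), ‖F (fun i => sch.a k • siteToE (↑(x i) : Site 4))‖ := hstep
    _ ≤ (12 * (r.N : ℝ)) ^ p * ∑ x ∈ (Finset.univ : Finset (Fin p → ↥(box 4 (sch.L k)))).filter
        (fun x => ∃ (i : Fin p) (μ : Fin 4), (sch.L k : ℝ) < 8 * |(((x i : Site 4) μ : ℤ) : ℝ)|), ‖F (fun i => sch.a k • siteToE (↑(x i) : Site 4))‖ :=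
        mul_le_mul_of_nonneg_left (Finset.sum_le_sum_of_subset_of_nonneg hsub fun x _ _ => norm_nonneg _)
          (by positivity)
    _ ≤ (12 * (r.N : ℝ)) ^ p * ((c₃ * 2 ^ (16 * N₁)) ^ (p + 1) * schwartzNorm (p * (4 * N₁ + 6)) F) :=
        mul_le_mul_of_nonneg_left hseam (by positivity)
    _ ≤ (12 * (r.N : ℝ) + 1) ^ (p + 1) * ((c₃ * 2 ^ (16 * N₁)) ^ (p + 1) * schwartzNorm (p * (4 * N₁ + 6)) F) := by
        refine mul_le_mul_of_nonneg_right ?_ (by positivity)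
        calc (12 * (r.N : ℝ)) ^ p ≤ (12 * (r.N : ℝ) + 1) ^ p := pow_le_pow_left₀ hN0 (by linarith) p
          _ ≤ (12 * (r.N : ℝ) + 1) ^ (p + 1) := pow_le_pow_right₀ (by linarith) (Nat.le_succ p)
    _ = ((12 * (r.N : ℝ) + 1) * (c₃ * 2 ^ (16 * N₁))) ^ (p + 1) * schwartzNorm (p * (4 * N₁ + 6)) F := by
        rw [← mul_assoc, ← mul_pow]

end NearOut

end Summit.QuantumFields.YangMills.Theorems.ContinuumLegGivenGap

end
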